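import Literature.AlgebraicGeometry.HodgeTheory.KunnethStandardConjectureSurjections
import Literature.AlgebraicGeometry.HodgeTheory.KunnethComponentsDiagonalAlgebraicPart
import Literature.AlgebraicGeometry.HodgeTheory.CorrespondenceTranspose
import HarnessLib

/-!
# The Künneth components of a push–pull class `[(f, g)_* 1]`: under `C(S)` the graded pieces of
# `f_* g^*` are algebraic correspondences

Family `hodge`, layer `Literature/AlgebraicGeometry/HodgeTheory`; namespace
`Literature.AlgebraicGeometry.HodgeTheory`. Theorems only (no definition, no named fact, sorry-free).

For smooth projective complex varieties `S`, `W`, `X` of dimensions `l`, `m`, `n` and morphisms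
`f : S ⟶ W`, `g : S ⟶ X`, the class `[(f, g)_* 1] ∈ H^{2e}((W ⊗ X)(ℂ); ℂ)` (`l + e = m + n`; the
image of the fundamental class of `S` under `(f, g) : S ⟶ W ⊗ X` — a graph class when `g = 𝟙`, a
Hecke-type correspondence when `f`, `g` are two projections of a cover) acts as the push–pull operator
`f_* ∘ g^*` (the tree's `corrAction_complexGysin_lift_one`; Fulton Def. 16.1.2, Prop. 16.1.1 (c)).
Since `(f, g) = Δ_S ≫ (f ⊗ g)`, a Künneth decomposition `cl(Δ_S) = Σ_d π_S d` of the diagonal of `S`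
gives `[(f, g)_* 1] = Σ_d (f ⊗ g)_* π_S d`, and `(f ⊗ g)_* π_S d` acts as `f_* ∘ (π_S d)_* ∘ g^*`
(the tree's `corrAction_complexGysin_tensorHom`), i.e. as `f_* g^*` on `H^{2l−d}` pulled back from
`H^{2l−d}(X(ℂ))` and as zero elsewhere. Reading Künneth components through their ACTION
(`eq_of_forall_corrAction_eq`, Voisin's "`Hᵏ(X) ⊗ Hˡ(Y) ≅ Hom(H^{2n−k}(X), Hˡ(Y))`"), this identifies
every Künneth component of `[(f, g)_* 1]`, for EVERY Künneth decomposition `ρ` of it: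

* §1 `corrAction_complexGysin_tensorHom_kunnethComponent_of_add_eq/_of_add_ne` — the action of
  `(f ⊗ g)_* π_S d`: `f_* ∘ g^*` on `Hᵃ(X(ℂ))` for `a + d = 2l`, zero for `a + d ≠ 2l`.
* §2 **`kunnethComponent_pushPullClass_eq`** — the component of `X`-degree `i` with `i + 2l = d + 2n`
  IS `(f ⊗ g)_* π_S d`; **`kunnethComponent_pushPullClass_eq_zero_of_lt`** — the components of
  `X`-degree `i < 2(n − l)` vanish (they would act on `Hᵃ(X)`, `a > 2l`, through `g^* : Hᵃ(X) → Hᵃ(S) = 0`);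
  `kunnethComponent_pushPullClass_eq_zero_of_gt` — so do those of `X`-degree `i > 2n`.
* §3 **`kunnethComponent_pushPullClass_mem_algebraicClasses`** — **under `C(S)` every Künneth
  component of `[(f, g)_* 1]` is algebraic** (Gysin images of algebraic classes are algebraic), and the
  family-free form `…_of_forall`. The case `g = 𝟙` is `KunnethComponentsOfGraphClasses`; exchanging
  `f` and `g` covers the transposed classes.

## References

* [Fulton1998] W. Fulton, Intersection Theory, 2nd ed., Springer 1998, §16.1 Def. 16.1.1,
  Prop. 16.1.1 (b)–(c), Def. 16.1.2.
* [Kahn2020] B. Kahn, Zeta and L-functions of varieties and motives, LMS LN 462, CUP 2020, §3.5.3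
  Example 3.47; §6.9 Def. 6.29, Lemma 6.30.
* [VoisinHodgeI2002] C. Voisin, Hodge Theory and Complex Algebraic Geometry I, CUP 2002, §11.3.3
  pp. 286–287.
* [Voisin2025] C. Voisin, Hodge and generalized Hodge conjectures, coniveau and algebraic cycles,
  J. Open Math. Probl. 1 (2025), §3.2.1 (12)–(14).
-/

noncomputable section

open CategoryTheory AlgebraicGeometry MonoidalCategory CartesianMonoidalCategory Finset
open Literature.AlgebraicTopology.SingularHomology
open Literature.AlgebraicGeometry.Motives (IsSmoothProjective ComplexPoints)

namespace Literature.AlgebraicGeometry.HodgeTheory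

variable {l m n : ℕ} {S W X : Motives.SchemeOver ℂ}

/-! ### §1 The action of `(f ⊗ g)_* π_S d` -/

section Action

variable {π : Fin (2 * l + 1) → complexBetti (S ⊗ S) (2 * l)}

/-- **`((f ⊗ g)_* π_S d)_* = f_* ∘ g^*` on `Hᵃ(X(ℂ); ℂ)` for `a + d = 2 dim S`** (complex orientations;
every Künneth decomposition `cl(Δ_S) = Σ π_S d`): the pushed-forward class acts as `f_* ∘ (π_S d)_* ∘ g^*`
and `π_S d` acts as the identity on `H^{2l−d}(S(ℂ))`. [cite: Fulton1998, §16.1 Prop. 16.1.1 (c)]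
[cite: Voisin2025, §3.2.1 (14)] -/
theorem corrAction_complexGysin_tensorHom_kunnethComponent_of_add_eq (hS : IsSmoothProjective l S)
    (hW : IsSmoothProjective m W) (hX : IsSmoothProjective n X) (f : S ⟶ W) (g : S ⟶ X) {e : ℕ}
    (hle : 2 * l + 2 * (m + n) = 2 * e + 2 * (l + l))
    (hπ : ∀ i : Fin (2 * l + 1), π i ∈ kunnethPiece S S (show (2 * l - (i : ℕ)) + i = 2 * l by omega))
    (hΔ : ∑ i, π i = diagonalClass hS) (d : Fin (2 * l + 1)) {a b : ℕ} (hab : a + 2 * e = b + 2 * n)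
    (ha : a + d = 2 * l) :
    corrAction complexOrientationFamily hW hX hab
        (complexGysin complexOrientationFamily (Motives.IsSmoothProjective.tensor_holds hS hS)
          (Motives.IsSmoothProjective.tensor_holds hW hX) (f ⊗ₘ g) hle (π d)) =
      complexGysin complexOrientationFamily hS hW f (show a + 2 * m = b + 2 * l by omega) ∘ₗ
        (complexBetti.map g a).hom := by
  ext c
  rw [LinearMap.comp_apply,
    corrAction_complexGysin_tensorHom complexOrientationFamily hS hS hW hX f g (e₁ := n) (by omega) hle
      (rfl : a + 2 * l = a + 2 * l) (show a + 2 * m = b + 2 * l by omega) hab (π d) c,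
    corrAction_kunnethComponent_diagonalClass_apply_of_add_eq hS hπ hΔ d rfl ha]

/-- **`((f ⊗ g)_* π_S d)_* = 0` on `Hᵃ(X(ℂ); ℂ)` for `a + d ≠ 2 dim S`** (any orientation family, any family
`π_S d ∈ H^{2l−d}(S) ⊗ Hᵈ(S)`). [cite: Fulton1998, §16.1 Prop. 16.1.1 (c)] [cite: Voisin2025, §3.2.1 (14)] -/
theorem corrAction_complexGysin_tensorHom_kunnethComponent_of_add_ne (μ : OrientationFamily)
    (hS : IsSmoothProjective l S) (hW : IsSmoothProjective m W) (hX : IsSmoothProjective n X)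
    (f : S ⟶ W) (g : S ⟶ X) {e : ℕ} (hle : 2 * l + 2 * (m + n) = 2 * e + 2 * (l + l))
    (hπ : ∀ i : Fin (2 * l + 1), π i ∈ kunnethPiece S S (show (2 * l - (i : ℕ)) + i = 2 * l by omega))
    (d : Fin (2 * l + 1)) {a b : ℕ} (hab : a + 2 * e = b + 2 * n) (ha : a + d ≠ 2 * l) :
    corrAction μ hW hX hab
        (complexGysin μ (Motives.IsSmoothProjective.tensor_holds hS hS)
          (Motives.IsSmoothProjective.tensor_holds hW hX) (f ⊗ₘ g) hle (π d)) = 0 := by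
  ext c
  rw [LinearMap.zero_apply,
    corrAction_complexGysin_tensorHom μ hS hS hW hX f g (e₁ := n) (by omega) hle
      (rfl : a + 2 * l = a + 2 * l) (show a + 2 * m = b + 2 * l by omega) hab (π d) c,
    corrAction_kunnethComponent_diagonalClass_of_add_ne μ hS hπ d rfl ha, LinearMap.zero_apply, map_zero]

end Action

/-! ### §2 The Künneth components of `[(f, g)_* 1]`, identified by their action -/

section Components

variable {π : Fin (2 * l + 1) → complexBetti (S ⊗ S) (2 * l)} {e : ℕ}
  {ρ : Fin (2 * e + 1) → complexBetti (W ⊗ X) (2 * e)}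

/-- **The Künneth component of `[(f, g)_* 1]` of `X`-degree `i` is `(f ⊗ g)_* π_S d`, `d + 2n = i + 2l`**
(for every Künneth decomposition `ρ` of `[(f, g)_* 1] ∈ H^{2e}((W ⊗ X)(ℂ))`, `l + e = m + n`, and every
Künneth decomposition `π_S` of `cl(Δ_S)`): both classes act as `f_* g^*` on `H^{2n−i}(X(ℂ)) = H^{2l−d}`-indexed
degree and as zero in every other degree (§1; `corrAction_sum_kunnethComponents_of_add_eq`,
`corrAction_complexGysin_lift_one`), so they agree by faithfulness (`eq_of_forall_corrAction_eq`).
[cite: Fulton1998, §16.1 Prop. 16.1.1 (c) and Def. 16.1.2] [cite: VoisinHodgeI2002, §11.3.3 p. 286]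
[cite: Voisin2025, §3.2.1 (12)–(14)] -/
theorem kunnethComponent_pushPullClass_eq (hS : IsSmoothProjective l S) (hW : IsSmoothProjective m W)
    (hX : IsSmoothProjective n X) (f : S ⟶ W) (g : S ⟶ X) (hle : l + e = m + n)
    (hπ : ∀ i : Fin (2 * l + 1), π i ∈ kunnethPiece S S (show (2 * l - (i : ℕ)) + i = 2 * l by omega))
    (hΔ : ∑ i, π i = diagonalClass hS)
    (hρ : ∀ i : Fin (2 * e + 1), ρ i ∈ kunnethPiece W X (show (2 * e - (i : ℕ)) + i = 2 * e by omega))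
    (hΓ : ∑ i, ρ i =
      complexGysin complexOrientationFamily hS (Motives.IsSmoothProjective.tensor_holds hW hX)
        (lift f g) (show 0 + 2 * (m + n) = 2 * e + 2 * l by omega)
        (singularCohomology.one ℂ (ComplexPoints S)))
    (i : Fin (2 * e + 1)) (d : Fin (2 * l + 1)) (hid : (d : ℕ) + 2 * n = i + 2 * l) :
    ρ i = complexGysin complexOrientationFamily (Motives.IsSmoothProjective.tensor_holds hS hS)
        (Motives.IsSmoothProjective.tensor_holds hW hX) (f ⊗ₘ g)
        (show 2 * l + 2 * (m + n) = 2 * e + 2 * (l + l) by omega) (π d) := by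
  refine eq_of_forall_corrAction_eq complexOrientationFamily hW hX fun a b hab ↦ ?_
  by_cases ha : a + i = 2 * n
  · -- both act as `f_* g^*`
    rw [← corrAction_sum_kunnethComponents_of_add_eq complexOrientationFamily hW hX hρ hab i ha, hΓ,
      corrAction_complexGysin_lift_one complexOrientationFamily hS hW hX f g hle hab,
      corrAction_complexGysin_tensorHom_kunnethComponent_of_add_eq hS hW hX f g _ hπ hΔ d hab
        (by omega)]
  · -- both act as zero
    rw [corrAction_eq_zero_of_mem_kunnethPiece_of_ne complexOrientationFamily hW hX _ (hρ i) hab ha,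
      corrAction_complexGysin_tensorHom_kunnethComponent_of_add_ne complexOrientationFamily hS hW hX f g
        _ hπ d hab (by omega)]

/-- **The Künneth components of `[(f, g)_* 1]` of `X`-degree `i < 2(dim X − dim S)` vanish**: such a
component acts only on `H^{2n−i}(X(ℂ))`, where the whole class acts as `f_* ∘ g^*` through
`g^* : H^{2n−i}(X) → H^{2n−i}(S) = 0` (`2n − i > 2 dim S`); by faithfulness it is zero.
[cite: VoisinHodgeI2002, §11.3.3 p. 286] [cite: Voisin2025, §3.2.1 (12)–(13)] -/
theorem kunnethComponent_pushPullClass_eq_zero_of_lt (hS : IsSmoothProjective l S)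
    (hW : IsSmoothProjective m W) (hX : IsSmoothProjective n X) (f : S ⟶ W) (g : S ⟶ X)
    (hle : l + e = m + n)
    (hρ : ∀ i : Fin (2 * e + 1), ρ i ∈ kunnethPiece W X (show (2 * e - (i : ℕ)) + i = 2 * e by omega))
    (hΓ : ∑ i, ρ i =
      complexGysin complexOrientationFamily hS (Motives.IsSmoothProjective.tensor_holds hW hX)
        (lift f g) (show 0 + 2 * (m + n) = 2 * e + 2 * l by omega)
        (singularCohomology.one ℂ (ComplexPoints S)))
    (i : Fin (2 * e + 1)) (hi : (i : ℕ) + 2 * l < 2 * n) : ρ i = 0 := by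
  refine eq_zero_of_forall_corrAction_eq_zero complexOrientationFamily hW hX fun a b hab ↦ ?_
  by_cases ha : a + i = 2 * n
  · rw [← corrAction_sum_kunnethComponents_of_add_eq complexOrientationFamily hW hX hρ hab i ha, hΓ,
      corrAction_complexGysin_lift_one complexOrientationFamily hS hW hX f g hle hab]
    -- `Hᵃ(S(ℂ)) = 0` since `a > 2 dim S`
    haveI := subsingleton_complexBetti hS (show 2 * l < a by omega)
    ext c
    rw [LinearMap.comp_apply, LinearMap.zero_apply]
    change complexGysin complexOrientationFamily hS hW f _ (complexBetti.map g a c) = 0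
    rw [Subsingleton.elim (complexBetti.map g a c) 0, map_zero]
  · exact corrAction_eq_zero_of_mem_kunnethPiece_of_ne complexOrientationFamily hW hX _ (hρ i) hab ha

/-- **The Künneth components of `X`-degree `i > 2 dim X` vanish** (the piece `H^{2e−i}(W) ⊗ Hⁱ(X)` is zero).
[cite: VoisinHodgeI2002, §11.3.3 p. 286] -/
theorem kunnethComponent_pushPullClass_eq_zero_of_gt (hX : IsSmoothProjective n X)
    (hρ : ∀ i : Fin (2 * e + 1), ρ i ∈ kunnethPiece W X (show (2 * e - (i : ℕ)) + i = 2 * e by omega))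
    (i : Fin (2 * e + 1)) (hi : 2 * n < (i : ℕ)) : ρ i = 0 := by
  haveI := subsingleton_complexBetti hX hi
  have h := hρ i
  rw [kunnethPiece_eq_bot_of_subsingleton_right (X := W) (Y := X), Submodule.mem_bot] at h
  exact h

/-! ### §3 Algebraicity under `C(S)` -/

/-- **Under `C(S)` every Künneth component of the push–pull class `[(f, g)_* 1] ∈ H^{2e}((W ⊗ X)(ℂ); ℂ)`
is algebraic** (`f : S ⟶ W`, `g : S ⟶ X`, `l + e = m + n`, `dim W ≤ dim S`; any Künneth decomposition
`ρ`): each component is `(f ⊗ g)_* π_S d` for the algebraic Künneth component `π_S d`,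
`d + 2n = i + 2l`, of `cl(Δ_S)` (§2) — a Gysin image of an algebraic class — or zero. These are the
algebraic correspondences inducing the graded pieces of `f_* ∘ g^*`.
[cite: Kahn2020, §6.9 Def. 6.29 and Lemma 6.30] [cite: Fulton1998, §16.1 Prop. 16.1.1 (c)]
[cite: VoisinHodgeII2003, §9.2.4 Prop. 9.21 (ii)] -/
theorem kunnethComponent_pushPullClass_mem_algebraicClasses (hS : IsSmoothProjective l S)
    (hW : IsSmoothProjective m W) (hX : IsSmoothProjective n X) (f : S ⟶ W) (g : S ⟶ X)
    (hle : l + e = m + n) (hml : m ≤ l)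
    (hπ : ∀ i : Fin (2 * l + 1), π i ∈ kunnethPiece S S (show (2 * l - (i : ℕ)) + i = 2 * l by omega))
    (hΔ : ∑ i, π i = diagonalClass hS) (hC : ∀ i, π i ∈ algebraicClasses (S ⊗ S) l)
    (hρ : ∀ i : Fin (2 * e + 1), ρ i ∈ kunnethPiece W X (show (2 * e - (i : ℕ)) + i = 2 * e by omega))
    (hΓ : ∑ i, ρ i =
      complexGysin complexOrientationFamily hS (Motives.IsSmoothProjective.tensor_holds hW hX)
        (lift f g) (show 0 + 2 * (m + n) = 2 * e + 2 * l by omega)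
        (singularCohomology.one ℂ (ComplexPoints S)))
    (i : Fin (2 * e + 1)) :
    ρ i ∈ algebraicClasses (W ⊗ X) e := by
  have hi := i.isLt
  by_cases hlt : (i : ℕ) + 2 * l < 2 * n
  · rw [kunnethComponent_pushPullClass_eq_zero_of_lt hS hW hX f g hle hρ hΓ i hlt]
    exact Submodule.zero_mem _
  · -- the component is `(f ⊗ g)_* π_S d`, `d = i + 2l − 2n ≤ 2l` (as `i ≤ 2e` and `m ≤ l`)
    have hd : (i : ℕ) + 2 * l - 2 * n < 2 * l + 1 := by omega
    rw [kunnethComponent_pushPullClass_eq hS hW hX f g hle hπ hΔ hρ hΓ i ⟨(i : ℕ) + 2 * l - 2 * n, hd⟩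
      (by simp only; omega)]
    exact complexGysin_mem_algebraicClasses_of_mem_algebraicClasses complexOrientationFamily
      (Motives.IsSmoothProjective.tensor_holds hS hS) (Motives.IsSmoothProjective.tensor_holds hW hX)
      (f ⊗ₘ g) _ (hC _)

end Components

/-- **Under `C(S)` every Künneth component of `[(f, g)_* 1]` is algebraic**, family-free form
(`f : S ⟶ W`, `g : S ⟶ X`, `l + e = m + n`, `dim W ≤ dim S`; Künneth decompositions of `cl(Δ_S)` exist,
`nonempty_kunnethComponents_diagonalClass`). [cite: Kahn2020, §6.9 Def. 6.29 and Lemma 6.30]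
[cite: Fulton1998, §16.1 Prop. 16.1.1 (c)] -/
theorem kunnethComponent_pushPullClass_mem_algebraicClasses_of_forall (hS : IsSmoothProjective l S)
    (hW : IsSmoothProjective m W) (hX : IsSmoothProjective n X) (f : S ⟶ W) (g : S ⟶ X) {e : ℕ}
    (hle : l + e = m + n) (hml : m ≤ l)
    (hCS : ∀ (πS : Fin (2 * l + 1) → complexBetti (S ⊗ S) (2 * l)),
      (∀ i : Fin (2 * l + 1), πS i ∈ kunnethPiece S S (show (2 * l - (i : ℕ)) + i = 2 * l by omega)) →
      ∑ i, πS i = diagonalClass hS → ∀ i, πS i ∈ algebraicClasses (S ⊗ S) l)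
    {ρ : Fin (2 * e + 1) → complexBetti (W ⊗ X) (2 * e)}
    (hρ : ∀ i : Fin (2 * e + 1), ρ i ∈ kunnethPiece W X (show (2 * e - (i : ℕ)) + i = 2 * e by omega))
    (hΓ : ∑ i, ρ i =
      complexGysin complexOrientationFamily hS (Motives.IsSmoothProjective.tensor_holds hW hX)
        (lift f g) (show 0 + 2 * (m + n) = 2 * e + 2 * l by omega)
        (singularCohomology.one ℂ (ComplexPoints S)))
    (i : Fin (2 * e + 1)) :
    ρ i ∈ algebraicClasses (W ⊗ X) e := by
  obtain ⟨⟨πS, hπS, hΔS⟩⟩ := nonempty_kunnethComponents_diagonalClass hS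
  exact kunnethComponent_pushPullClass_mem_algebraicClasses hS hW hX f g hle hml hπS hΔS
    (hCS πS hπS hΔS) hρ hΓ i

/-- **Hecke-type self-correspondences**: for two morphisms `f g : S ⟶ X` from a smooth projective `S`
to a smooth projective `X` OF THE SAME DIMENSION `n` and `C(S)`, every Künneth component of the
class `[(f, g)_* 1] ∈ H^{2n}((X ⊗ X)(ℂ); ℂ)` of the push–pull operator `f_* g^*` is algebraic.
[cite: Kahn2020, §6.9 Def. 6.29 and Lemma 6.30] [cite: Fulton1998, §16.1 Prop. 16.1.1 (c) and Ex. 16.1.13] -/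
theorem kunnethComponent_pushPullClass_mem_algebraicClasses_self (hS : IsSmoothProjective n S)
    (hX : IsSmoothProjective n X) (f g : S ⟶ X)
    (hCS : ∀ (πS : Fin (2 * n + 1) → complexBetti (S ⊗ S) (2 * n)),
      (∀ i : Fin (2 * n + 1), πS i ∈ kunnethPiece S S (show (2 * n - (i : ℕ)) + i = 2 * n by omega)) →
      ∑ i, πS i = diagonalClass hS → ∀ i, πS i ∈ algebraicClasses (S ⊗ S) n)
    {ρ : Fin (2 * n + 1) → complexBetti (X ⊗ X) (2 * n)}
    (hρ : ∀ i : Fin (2 * n + 1), ρ i ∈ kunnethPiece X X (show (2 * n - (i : ℕ)) + i = 2 * n by omega))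
    (hΓ : ∑ i, ρ i =
      complexGysin complexOrientationFamily hS (Motives.IsSmoothProjective.tensor_holds hX hX)
        (lift f g) (show 0 + 2 * (n + n) = 2 * n + 2 * n by omega)
        (singularCohomology.one ℂ (ComplexPoints S)))
    (i : Fin (2 * n + 1)) :
    ρ i ∈ algebraicClasses (X ⊗ X) n :=
  kunnethComponent_pushPullClass_mem_algebraicClasses_of_forall hS hX hX f g rfl le_rfl hCS hρ hΓ i

end Literature.AlgebraicGeometry.HodgeTheory

end
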